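/-
Copyright: the b2b-balaban cell (near-miss cell 7), T⁴-continuum fan-out; row NE7b, carrier debt (c) of the COUNT route
(finding F-ne7bp1g22-1(c)), seat `t4-ne7b-formalise-leaf-02`.  Released under the licence of the surrounding project.
-/
import Summits.QuantumFields.BalabanUV.T4Continuum.Support.HistoryBankingLE

/-!
# The banked induction WITHOUT the renewal-at-reach clause — part 2: the induction and the records-currency price

Summits-side support leaf of the T⁴-continuum cell (rung (B)+1 on a FINITE torus only; NOT infinite volume, NOT the
mass gap, NOT the Clay statement; NOT a proof of the spine estimate NE7b).  Row NE7b, route «COUNT»; the BANKING HALF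
of the carrier debt (c) (finding F-ne7bp1g22-1(c)); part 2 of `Support/HistoryBankingLE.lean` (see its header for WHY).
[folklore] bookkeeping over the lineage's OWN typed carrier; nothing is quoted from print, nothing printed is asserted,
no definition at all in this file, no `[cite:]` tag.

WHAT.  **`bankedLE_total`** — for every fresh `ConsistentTLE` genealogy the raw printed credits pay the TOTAL booked
cost, every event's retained bank and the root's reserve (pure additivity: `bornLE_pay`; `totalCostT_renew` +
`renewLE_pay`; `totalCostT_merge` + `mergeLE_pay` + `reserve_merge`); **`bankedLE_induction`** — the conclusion of
`T4BankedInduction.banked_induction` (`lifeCost + banks + reserve root ≤ credits`) via `lifeCost_le_totalCostT`;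
**`rawFactorLE_le_recordPrice`** — the exponentiated records-currency form, the exact shape of
`T4BankedInduction.rawFactor_le_recordPrice`.  All three under the SAME scale-indexed pay hypotheses `Hb Hr Hm` (and
`hC h29 hL hR1`) as `T4TaggedShapeBanking.banking_taggedShape`, with `ConsistentT` weakened to `ConsistentTLE` (renewal
at `h + 1 ≤ reach`) and well-formedness weakened to `LateMergers.FreshT`.

NOT DONE HERE.  The exits still ask `Consistent` ∕ `ConsistentTH` BY NAME (owner's remaining half of debt (c)); `D > 0`.
NE7b NOT proved; spine 0/9.  HONEST DEPENDENCY (cell): continuum YM on T⁴ ⇐ BetaPertH ∧ nine spine estimates (0/9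
proved); BetaPertH ⇐ (D1) ∧ (D4) ∧ CAP+tail.  This file changes none of it.
-/

open Finset
open Literature.MathematicalPhysics.QuantumFieldTheory.Balaban1983to89
open T4PersistenceDictionary T4PrintedShapeBanking T4BankedInduction T4BranchingRecordsGas T4TaggedShapeBanking
open Summit.QuantumFields.BalabanUV.T4Continuum.LateMergers
open Summit.QuantumFields.BalabanUV.T4Continuum.HistoryBankingLE

namespace Summit.QuantumFields.BalabanUV.T4Continuum.HistoryBankingLEInduction

noncomputable section

/-! ## §1 The banked induction on the total booked cost -/

section Induction

variable {ε : Type*} [DecidableEq ε] {sh : ε → PEv} {C : T4PrintedShapeBanking.Consts} {K L : ℕ} {R : ℕ → ℕ}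
  {g : ℕ → ℝ} {β' β₀ : ℝ}

/-- **THE BANKED INDUCTION ON THE TOTAL BOOKED COST**: for every fresh `ConsistentTLE` genealogy the raw printed credits
pay the TOTAL booked cost AND every event's retained bank AND the root's reserve — pure additivity: birth
(`bornLE_pay`), renewal (`totalCostT_renew` + `renewLE_pay`), merger (`totalCostT_merge` + `mergeLE_pay` + the two
roots re-booked by `reserve_merge`). [folklore] -/
theorem bankedLE_total (hC : C.Valid) (h29 : B14FlowStep.FlowIneq29 R g L β' β₀ K) (hL : 1 ≤ L)
    (hR1 : ∀ s, s ≤ K → 1 ≤ R s)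
    (Hb : ∀ s, s ≤ K → ∀ d' : ℕ,
      (C.Eb + C.μ + (3 * C.E₂ * (L : ℝ) ^ C.q' + C.E₃ * (L : ℝ) ^ C.q' + 3 * C.κ₁) * (R s : ℝ) ^ (C.q' + 1)) *
          ((d' : ℝ) + 1) + 2 * p0Profile C.A₀ C.p₀ (g s) ≤
        C.a * (p0Profile C.A₀ C.p₀ (g s)) ^ 2 * ((d' : ℝ) + 1) + 2 * p0Profile C.A₀ C.p₀ (g s))
    (Hr : ∀ h, h + 1 ≤ K →
      2 * C.E₂ * (L : ℝ) ^ C.q' * (R (h + 1) : ℝ) ^ (C.q' + 1) + (C.κ₁ * ((R (h + 1) : ℝ) + 1) + C.E₀) ≤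
        p0Profile C.A₀ C.p₀ (g h))
    (Hm : ∀ m s, m ≤ s → s ≤ K →
      ((1 + C.n₁) * C.E₂ * (L : ℝ) ^ C.q' + C.dC * C.E₃ * (L : ℝ) ^ C.q') * (R s : ℝ) ^ (C.q' + 1) +
          (C.κ₁ * ((C.n₁ : ℝ) + R s) + C.E₀) ≤ 2 * p0Profile C.A₀ C.p₀ (g m)) :
    ∀ G : Gen ε, ConsistentTLE sh C K R G → FreshT G →
      totalCostT sh C K R G + banks (fun e => C.κ₁ * ((dictWT sh R C.n₁ e : ℕ) : ℝ) + Emarg C (sh e)) G +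
          reserve C g (sh G.root) ≤ credits (credit C g ∘ sh) G
  | Gen.born b j, hc, _ => by
      have h := bornLE_pay hC h29 hL hR1 Hb b j hc
      simpa [totalCostT_born, banks, credits] using h
  | Gen.renew G e h, hc, hf => by
      simp only [FreshT] at hf
      obtain ⟨hfG, he⟩ := hf
      have hc' := hc
      simp only [ConsistentTLE] at hc'
      obtain ⟨hG, hk, hs, -, hK⟩ := hc'
      have IH := bankedLE_total hC h29 hL hR1 Hb Hr Hm G hG hfG
      have hpay := renewLE_pay (C := C) (K := K) hC h29 hL hR1 Hr hk hs hK
      have hb : banks (fun e => C.κ₁ * ((dictWT sh R C.n₁ e : ℕ) : ℝ) + Emarg C (sh e)) (Gen.renew G e h) =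
          (C.κ₁ * ((dictWT sh R C.n₁ e : ℕ) : ℝ) + Emarg C (sh e)) +
            banks (fun e => C.κ₁ * ((dictWT sh R C.n₁ e : ℕ) : ℝ) + Emarg C (sh e)) G := by
        simp [banks, sum_insert he]
      rw [totalCostT_renew he, hb, credits_renew _ h he, root_renew]
      simp only [Function.comp] at IH ⊢
      linarith
  | Gen.merge X Y e, hc, hf => by
      simp only [FreshT] at hf
      obtain ⟨hfX, hfY, heX, heY, hXY⟩ := hf
      have hc' := hc
      simp only [ConsistentTLE] at hc'
      obtain ⟨hX, hY, -⟩ := hc'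
      have IHX := bankedLE_total hC h29 hL hR1 Hb Hr Hm X hX hfX
      have IHY := bankedLE_total hC h29 hL hR1 Hb Hr Hm Y hY hfY
      have hpay := mergeLE_pay hC h29 hL hR1 Hm X Y e hc
      have hres := reserve_merge (reserve C g ∘ sh) X Y e
      have he : e ∉ X.events ∪ Y.events := by simp [heX, heY]
      have hb : banks (fun e => C.κ₁ * ((dictWT sh R C.n₁ e : ℕ) : ℝ) + Emarg C (sh e)) (Gen.merge X Y e) =
          (C.κ₁ * ((dictWT sh R C.n₁ e : ℕ) : ℝ) + Emarg C (sh e)) +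
            (banks (fun e => C.κ₁ * ((dictWT sh R C.n₁ e : ℕ) : ℝ) + Emarg C (sh e)) X +
              banks (fun e => C.κ₁ * ((dictWT sh R C.n₁ e : ℕ) : ℝ) + Emarg C (sh e)) Y) := by
        simp [banks, sum_insert he, sum_union hXY]
      rw [totalCostT_merge heX heY hXY, hb, credits_merge _ heX heY hXY]
      simp only [Function.comp] at IHX IHY hres ⊢
      linarith

/-- **THE BANKED INDUCTION WITHOUT THE RENEWAL-AT-REACH CLAUSE** — the conclusion of
`T4BankedInduction.banked_induction` (`lifeCost + banks + reserve root ≤ credits`) for every fresh `ConsistentTLE`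
genealogy, under the SAME scale-indexed pay hypotheses as `T4TaggedShapeBanking.banking_taggedShape`. [folklore] -/
theorem bankedLE_induction (hC : C.Valid) (h29 : B14FlowStep.FlowIneq29 R g L β' β₀ K) (hL : 1 ≤ L)
    (hR1 : ∀ s, s ≤ K → 1 ≤ R s)
    (Hb : ∀ s, s ≤ K → ∀ d' : ℕ,
      (C.Eb + C.μ + (3 * C.E₂ * (L : ℝ) ^ C.q' + C.E₃ * (L : ℝ) ^ C.q' + 3 * C.κ₁) * (R s : ℝ) ^ (C.q' + 1)) *
          ((d' : ℝ) + 1) + 2 * p0Profile C.A₀ C.p₀ (g s) ≤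
        C.a * (p0Profile C.A₀ C.p₀ (g s)) ^ 2 * ((d' : ℝ) + 1) + 2 * p0Profile C.A₀ C.p₀ (g s))
    (Hr : ∀ h, h + 1 ≤ K →
      2 * C.E₂ * (L : ℝ) ^ C.q' * (R (h + 1) : ℝ) ^ (C.q' + 1) + (C.κ₁ * ((R (h + 1) : ℝ) + 1) + C.E₀) ≤
        p0Profile C.A₀ C.p₀ (g h))
    (Hm : ∀ m s, m ≤ s → s ≤ K →
      ((1 + C.n₁) * C.E₂ * (L : ℝ) ^ C.q' + C.dC * C.E₃ * (L : ℝ) ^ C.q') * (R s : ℝ) ^ (C.q' + 1) +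
          (C.κ₁ * ((C.n₁ : ℝ) + R s) + C.E₀) ≤ 2 * p0Profile C.A₀ C.p₀ (g m))
    {G : Gen ε} (hc : ConsistentTLE sh C K R G) (hf : FreshT G) :
    lifeCost (dictWT sh R C.n₁) (costT sh C K R) G +
        banks (fun e => C.κ₁ * ((dictWT sh R C.n₁ e : ℕ) : ℝ) + Emarg C (sh e)) G + reserve C g (sh G.root) ≤
      credits (credit C g ∘ sh) G := by
  have h1 := lifeCost_le_totalCostT (sh := sh) (K := K) (R := R) hC.E₂_nonneg hC.E₃_nonneg G
  have h2 := bankedLE_total hC h29 hL hR1 Hb Hr Hm G hc hf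
  linarith

/-- **THE RAW FACTOR IS BELOW THE RECORDS-CURRENCY PRICE, WITHOUT THE RENEWAL-AT-REACH CLAUSE** — the exact shape
of `T4BankedInduction.rawFactor_le_recordPrice` (`e^{−credits}·e^{+lifeCost} ≤ ρ_root·e^{−κ₁W root}·∏_{record}
(e^{−κ₁W e}·η_e)`, `ρ = e^{−(reserve + E)}`, `η = e^{−E}`) for every fresh `ConsistentTLE` genealogy. [folklore] -/
theorem rawFactorLE_le_recordPrice (hC : C.Valid) (h29 : B14FlowStep.FlowIneq29 R g L β' β₀ K) (hL : 1 ≤ L)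
    (hR1 : ∀ s, s ≤ K → 1 ≤ R s)
    (Hb : ∀ s, s ≤ K → ∀ d' : ℕ,
      (C.Eb + C.μ + (3 * C.E₂ * (L : ℝ) ^ C.q' + C.E₃ * (L : ℝ) ^ C.q' + 3 * C.κ₁) * (R s : ℝ) ^ (C.q' + 1)) *
          ((d' : ℝ) + 1) + 2 * p0Profile C.A₀ C.p₀ (g s) ≤
        C.a * (p0Profile C.A₀ C.p₀ (g s)) ^ 2 * ((d' : ℝ) + 1) + 2 * p0Profile C.A₀ C.p₀ (g s))
    (Hr : ∀ h, h + 1 ≤ K →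
      2 * C.E₂ * (L : ℝ) ^ C.q' * (R (h + 1) : ℝ) ^ (C.q' + 1) + (C.κ₁ * ((R (h + 1) : ℝ) + 1) + C.E₀) ≤
        p0Profile C.A₀ C.p₀ (g h))
    (Hm : ∀ m s, m ≤ s → s ≤ K →
      ((1 + C.n₁) * C.E₂ * (L : ℝ) ^ C.q' + C.dC * C.E₃ * (L : ℝ) ^ C.q') * (R s : ℝ) ^ (C.q' + 1) +
          (C.κ₁ * ((C.n₁ : ℝ) + R s) + C.E₀) ≤ 2 * p0Profile C.A₀ C.p₀ (g m))
    {G : Gen ε} (hc : ConsistentTLE sh C K R G) (hf : FreshT G) :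
    Real.exp (-credits (credit C g ∘ sh) G) * Real.exp (lifeCost (dictWT sh R C.n₁) (costT sh C K R) G) ≤
      (Real.exp (-(reserve C g (sh G.root) + Emarg C (sh G.root))) *
          Real.exp (-(C.κ₁ * ((dictWT sh R C.n₁ G.root : ℕ) : ℝ)))) *
        ∏ e ∈ G.events.erase G.root,
          (Real.exp (-(C.κ₁ * ((dictWT sh R C.n₁ e : ℕ) : ℝ))) * Real.exp (-Emarg C (sh e))) := by
  have h0 := bankedLE_induction hC h29 hL hR1 Hb Hr Hm hc hf
  have h1 : Real.exp (-credits (credit C g ∘ sh) G) * Real.exp (lifeCost (dictWT sh R C.n₁) (costT sh C K R) G) ≤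
      Real.exp (-banks (fun e => C.κ₁ * ((dictWT sh R C.n₁ e : ℕ) : ℝ) + Emarg C (sh e)) G) *
        Real.exp (-reserve C g (sh G.root)) := by
    rw [← Real.exp_add, ← Real.exp_add, Real.exp_le_exp]
    linarith
  rw [exp_neg_banks_eq C.κ₁ (fun e => ((dictWT sh R C.n₁ e : ℕ) : ℝ)) (fun e => Emarg C (sh e)),
    ← mul_prod_erase _ _ G.root_mem] at h1
  have h2 : (Real.exp (-(C.κ₁ * ((dictWT sh R C.n₁ G.root : ℕ) : ℝ))) * Real.exp (-Emarg C (sh G.root))) *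
        (∏ e ∈ G.events.erase G.root,
          (Real.exp (-(C.κ₁ * ((dictWT sh R C.n₁ e : ℕ) : ℝ))) * Real.exp (-Emarg C (sh e)))) *
        Real.exp (-reserve C g (sh G.root)) =
      (Real.exp (-(reserve C g (sh G.root) + Emarg C (sh G.root))) *
          Real.exp (-(C.κ₁ * ((dictWT sh R C.n₁ G.root : ℕ) : ℝ)))) *
        ∏ e ∈ G.events.erase G.root,
          (Real.exp (-(C.κ₁ * ((dictWT sh R C.n₁ e : ℕ) : ℝ))) * Real.exp (-Emarg C (sh e))) := by
    have : Real.exp (-(reserve C g (sh G.root) + Emarg C (sh G.root))) =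
        Real.exp (-reserve C g (sh G.root)) * Real.exp (-Emarg C (sh G.root)) := by
      rw [← Real.exp_add]; congr 1; ring
    rw [this]; ring
  linarith [h2]

end Induction

end

end Summit.QuantumFields.BalabanUV.T4Continuum.HistoryBankingLEInduction
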